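import Summits.BirchSwinnertonDyer.Rank1Residual.Additive.X4SharpThreeKimShapeConsequences
import HarnessLib

/-!
# N11 — the UNIT shape of "Kim 2026 Thm. 1.8 (1)+(6) at `p = 3`": consistency with the closed rows,
# exact boundary, the LOWER-row lever and the falsifiable Tamagawa prediction (cell `b2b-bsdres`,
# team n1011, seat p03, OWNERS row T-a2; THEOREMS ONLY; sequel of
# `Additive/X4SharpThreeKimShapeConsequences.lean`)

HONEST FRAMING (cell `b2b-bsdres`, run/shared/lean/b2b/bsd-rank1-residual/, verbatim in every
file): the goal of the cell is to DELETE the COMBINATION-SHAPED residual classes of the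
Birch–Swinnerton-Dyer formula for ALL analytic-rank `≤ 1` elliptic curves over `ℚ` — "full BSD
formula for every rank `≤ 1` curve in class `C`" assembled STRICTLY from published theorems — so
that the rank-`≤ 1` remainder becomes exactly the CONSTRUCTION-SHAPED classes, which are TYPED
(missing-input `Prop`s), NOT attempted. This is not "finishing BSD". Team n1011 (N10 / N11): prove
what is provable now; shrink each hard class to its core with data; no claim beyond stated classes.
Research routes; census output = EVIDENCE / conjecture items, never a Literature fact. The label X4
is UNCHANGED by this file; nothing is booked. Theorems only (no definition, no named fact minted;
GZK `hGZK` / modularity `hmod` explicit; the conjectures `X4SharpThreeKimUnit` /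
`KimRankZeroUnitBoundAt W p` of `Additive/X4SharpThreeKimShape.lean` enter ONLY as hypotheses).

## What this file proves

§4 **Consistency** (fact-free): the inequality shape `KimRankZeroBoundAt W p` HOLDS at every pair
where `BSD(E,p)` holds (`kimRankZeroBoundAt_of_bsdp`), and the unit shape `KimRankZeroUnitBoundAt W p`
at every `BSD(E,p)` pair with `p ∤ ∏ c_ℓ` — no kernel-closed N11 row can contradict either.
§5 **The unit shape's exact boundary** at ANY prime: under `KimRankZeroUnitBoundAt W p` and ONE unit
cyclic-level Kurihara number, `BSD(E,p) ⟺ p ∤ ∏ c_ℓ` (via the fact-free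
`X4.bsdp_iff_not_dvd_tamagawaProduct_of_rankZero_witness`); whence (a) **the LOWER lever**
`bsdp_of_kimRankZeroUnitBoundAt_of_kuriharaUnitAt` — `p ∤ ∏ c_ℓ` + one unit Kurihara number ⟹
`BSD(E,p)`, BOTH halves, reaching the `p ∣ #Ш_an` rows that no upper-bound route touches (at `5 ≤ p`
Kim's theorem; at `p = 3` conditional on the conjecture); (b) **the falsifiable prediction**
`not_kuriharaUnitAt_of_kimRankZeroUnitBoundAt_of_bsdp_of_dvd` — on a pair with `p ∣ ∏ c_ℓ` where
`BSD(E,p)` holds, NO unit cyclic-level Kurihara number exists. §6 The `p = 3` census shapes with the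
cell's tower certificates (`j`-witness ∨ surj(9)): `X4RankZero.bsdp_three_of_kimShape_of_cert_of_shaAn_unit`,
`…missingUpperBoundAt_three_of_kimShape_of_cert`, **`…bsdp_three_of_kimUnitShape_of_cert_of_kuriharaUnitAt`**
(the LOWER rows of N11 — additive-p4 V25b: 84 + 1 window rows, one `3`-descent each so far — become
closable by ONE modular-symbol certificate MODULO `X4SharpThreeKimUnit`),
`…not_kuriharaUnitAt_three_of_kimUnitShape_of_bsdp_of_dvd` (census target: the parity-closed
Tamagawa-defect rows, V23/V24). EVIDENCE protocol: cells/n1011/skel/T-a2.md §3 S8.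

References: C.-H. Kim, Amer. J. Math. 148 (2026) = arXiv:2203.12159v4 Thm. 1.9 (1), (6), Conj. 1.10
[Kim2022StructureSelmer]; R. Sakamoto, Doc. Math. 27 (2022) App. §5 [Sakamoto2022pSelmer];
Miller 2011 Def. 1.1 [Miller2011LMS]; Mazur 1977 III §5 [Mazur1977]; Serre 1968 IV §3.4.
-/

noncomputable section

open scoped Classical MatrixGroups ModularForm

open CongruenceSubgroup WeierstrassCurve Literature.NumberTheory.EllipticCurves
  Literature.NumberTheory.EllipticCurves.ModularForms
  Literature.NumberTheory.EllipticCurves.Rank1Residual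
  Literature.NumberTheory.EllipticCurves.Rank1Residual.Typed

namespace Summit.BirchSwinnertonDyer.Rank1Residual.Additive

variable (W : WeierstrassCurve ℚ) [W.IsElliptic] [W.IsGloballyMinimal] (p : ℕ) [Fact p.Prime]

/-! ## §4 Consistency: the shapes HOLD at every pair where `BSD(E,p)` holds -/

/-- **At a pair where Miller's `BSD(E,p)` holds, `KimRankZeroBoundAt W p` holds** (the inequality
`ord_p #Ш(p) ≤ ord_p(L(E,1)/Ω)` is `0 ≤ ord_p ∏ c_ℓ` there). Hence on every kernel-closed N11 row
the conjecture's instance is already a theorem (modulo that closure's named facts): the conjecture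
is CONSISTENT with the cell's whole closed census by construction. Fact-free.
[cite: Miller2011LMS, Def. 1.1] [cite: Mazur1977, Ch. III §5, p. 157] -/
theorem kimRankZeroBoundAt_of_bsdp (hB : BSDp W p) : KimRankZeroBoundAt W p := by
  intro hsurj _ hL _ N _ D _
  obtain ⟨hmw, hfinp, q, hq, hv⟩ := hB
  have hirr := hasIrreducibleModPGaloisRep_of_hasSurjectiveModNGaloisRep W p hsurj
  have hr0 : W.analyticRank = 0 := analyticRank_eq_zero_of_entireLFunction_one_ne_zero hL
  have hmw0 : W.mordellWeilRank = 0 := by rw [hmw, hr0]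
  have hΩ : (W.realPeriodRat : ℂ) ≠ 0 := by exact_mod_cast (W.realPeriodRat_pos_holds).ne'
  have ht0 : (W.torsionOrder : ℚ) ≠ 0 := by exact_mod_cast (W.torsionOrder_pos_holds).ne'
  have hc0 : (W.tamagawaProduct : ℚ) ≠ 0 := by exact_mod_cast (W.tamagawaProduct_pos').ne'
  have ht0' : (W.torsionOrder : ℂ) ≠ 0 := by exact_mod_cast (W.torsionOrder_pos_holds).ne'
  have hc0' : (W.tamagawaProduct : ℂ) ≠ 0 := by exact_mod_cast (W.tamagawaProduct_pos').ne'
  set q₀ : ℚ := q * (W.tamagawaProduct : ℚ) / (W.torsionOrder : ℚ) ^ 2 with hq₀def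
  have hq₀ : W.entireLFunction 1 / (W.realPeriodRat : ℂ) = (q₀ : ℂ) := by
    have hsha := hq
    rw [shaAn_def, WeierstrassCurve.leadingLCoeff, hr0, iteratedDeriv_zero, Nat.factorial_zero,
      Nat.cast_one, div_one, W.regulator_eq_one_of_rank_zero hmw0] at hsha
    rw [hq₀def]
    push_cast
    rw [div_eq_iff hΩ]
    have : W.entireLFunction 1 = (q : ℂ) * ((W.realPeriodRat : ℂ) * (W.tamagawaProduct : ℂ)) /
        (W.torsionOrder : ℂ) ^ 2 := by
      rw [eq_div_iff (pow_ne_zero 2 ht0'), ← hsha]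
      push_cast
      field_simp
    rw [this]
    field_simp
  have hq0 : q ≠ 0 := by
    rintro rfl
    have := rankZero_witness_ne_zero W hL hq₀
    simp [hq₀def] at this
  refine ⟨q₀, hq₀, ?_⟩
  have htors0 : padicValNat p W.torsionOrder = 0 :=
    padicValNat_torsionOrder_eq_zero_of_irreducible W p hirr
  have hvq : padicValRat p q₀ = padicValRat p q + padicValNat p W.tamagawaProduct := by
    have h2 : padicValRat p ((W.torsionOrder : ℚ) ^ 2) = 2 * padicValRat p (W.torsionOrder : ℚ) := by
      rw [pow_two, padicValRat.mul ht0 ht0]; ring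
    rw [hq₀def, padicValRat.div (mul_ne_zero hq0 hc0) (pow_ne_zero 2 ht0), padicValRat.mul hq0 hc0,
      h2, padicValRat.of_nat, padicValRat.of_nat, htors0]
    push_cast; ring
  rw [hvq, hv]
  have : (0 : ℤ) ≤ padicValNat p W.tamagawaProduct := Nat.cast_nonneg _
  linarith

/-- **At a pair where `BSD(E,p)` holds and `p ∤ ∏ c_ℓ`, `KimRankZeroUnitBoundAt W p` holds** (its
conclusion `ord_p(L(E,1)/Ω) = ord_p #Ш(p)` is BSD's, the Kurihara-number binders being unused).
Fact-free. [cite: Miller2011LMS, Def. 1.1] [cite: Kim2022StructureSelmer, Conj. 1.10 (PDF p. 8)] -/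
theorem kimRankZeroUnitBoundAt_of_bsdp_of_not_dvd (hB : BSDp W p)
    (htam : ¬ p ∣ W.tamagawaProduct) : KimRankZeroUnitBoundAt W p := by
  intro hsurj htower hL hfin N _ D hc _ n _ _ _ ψ _ _
  obtain ⟨q₀, hq₀, hle⟩ := kimRankZeroBoundAt_of_bsdp W p hB hsurj htower hL hfin D hc
  obtain ⟨hmw, hfinp, q, hq, hv⟩ := hB
  refine ⟨q₀, hq₀, le_antisymm ?_ hle⟩
  -- `ord_p q₀ = ord_p q + ord_p ∏ c_ℓ = ord_p #Ш(p) + 0`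
  have hirr := hasIrreducibleModPGaloisRep_of_hasSurjectiveModNGaloisRep W p hsurj
  have hq₀0 : q₀ ≠ 0 := rankZero_witness_ne_zero W hL hq₀
  have hsha := shaAn_eq_of_rankZero_witness W hmw hL hq₀
  have hqq : q = q₀ * (W.torsionOrder : ℚ) ^ 2 / (W.tamagawaProduct : ℚ) := by
    exact_mod_cast hq.symm.trans hsha
  have hvq := Supersingular.padicValRat_shaAn_witness W p hirr hq₀0
  rw [← hqq, hv, padicValNat.eq_zero_of_not_dvd htam, Nat.cast_zero, sub_zero] at hvq
  exact le_of_eq hvq.symm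

/-! ## §5 The unit shape: exact boundary, the LOWER lever, the falsifiable prediction -/

/-- **Under `KimRankZeroUnitBoundAt W p` and ONE unit cyclic-level Kurihara number,
`BSD(E,p) ⟺ p ∤ ∏ c_ℓ`** — the exact boundary of the Kurihara route
(`X4.bsdp_iff_not_dvd_tamagawaProduct_of_rankZero_witness`, fact-free), now at ANY prime including
`3`. GZK `hGZK`. [cite: Kim2022StructureSelmer, Thm. 1.9 (1), (6) and Conj. 1.10] [cite: Miller2011LMS, Def. 1.1] -/
theorem bsdp_iff_not_dvd_tamagawaProduct_of_kimRankZeroUnitBoundAt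
    (hGZK : rank_eq_analyticRank_of_analyticRank_le_one) (h : KimRankZeroUnitBoundAt W p)
    (hsurj : W.HasSurjectiveModNGaloisRep p)
    (htower : ∀ n : ℕ, W.HasSurjectiveModNGaloisRep (p ^ n : ℕ)) (hL : W.entireLFunction 1 ≠ 0)
    {N : ℕ} [NeZero N] (D : ModularParametrizationData W N) (hc : ¬ (p : ℤ) ∣ D.maninConstant)
    (hper : ∃ u : ℚ, ‖(u : ℚ_[p])‖ = 1 ∧ W.realPeriodRat = u * plusPeriod D.f)
    (hK : X4.KuriharaUnitAt W p D.f) : BSDp W p ↔ ¬ p ∣ W.tamagawaProduct := by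
  have hr0 : W.analyticRank = 0 := analyticRank_eq_zero_of_entireLFunction_one_ne_zero hL
  obtain ⟨hmw, hfin⟩ := hGZK W (by rw [hr0]; exact zero_le_one)
  obtain ⟨n, hn0, hn, hcyc, ψ, hψ, hδ⟩ := hK
  obtain ⟨q, hq, hval⟩ := h hsurj htower hL hfin D hc hper n hn hcyc ψ hψ hδ
  exact X4.bsdp_iff_not_dvd_tamagawaProduct_of_rankZero_witness W p hmw hfin hL
    (hasIrreducibleModPGaloisRep_of_hasSurjectiveModNGaloisRep W p hsurj) hq hval

/-- **The LOWER lever (any prime): `KimRankZeroUnitBoundAt W p` + `p ∤ ∏ c_ℓ` + ONE unit Kurihara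
number ⇒ `BSD(E,p)`, BOTH halves** — in particular on the rows with `p ∣ #Ш_an`, which no
upper-bound route reaches. At `5 ≤ p` this is `X4.bsdp_of_kuriharaUnitAt_of_analyticRank_eq_zero`
(Kim's theorem); at `p = 3` it is conditional on `X4SharpThreeKimUnit`.
[cite: Kim2022StructureSelmer, Thm. 1.9 (1), (6)] [cite: Miller2011LMS, Def. 1.1] -/
theorem bsdp_of_kimRankZeroUnitBoundAt_of_kuriharaUnitAt
    (hGZK : rank_eq_analyticRank_of_analyticRank_le_one) (h : KimRankZeroUnitBoundAt W p)
    (hsurj : W.HasSurjectiveModNGaloisRep p)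
    (htower : ∀ n : ℕ, W.HasSurjectiveModNGaloisRep (p ^ n : ℕ)) (hL : W.entireLFunction 1 ≠ 0)
    {N : ℕ} [NeZero N] (D : ModularParametrizationData W N) (hc : ¬ (p : ℤ) ∣ D.maninConstant)
    (hper : ∃ u : ℚ, ‖(u : ℚ_[p])‖ = 1 ∧ W.realPeriodRat = u * plusPeriod D.f)
    (htam : ¬ p ∣ W.tamagawaProduct) (hK : X4.KuriharaUnitAt W p D.f) : BSDp W p :=
  (bsdp_iff_not_dvd_tamagawaProduct_of_kimRankZeroUnitBoundAt W p hGZK h hsurj htower hL D hc hper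
    hK).mpr htam

/-- **The falsifiable prediction (any prime): under `KimRankZeroUnitBoundAt W p`, on a pair with
`p ∣ ∏ c_ℓ` where `BSD(E,p)` HOLDS there is NO unit cyclic-level Kurihara number** (for any choice of
surjective discrete logarithms). At `p = 3` the census can test this on every Tamagawa-obstructed N11
row closed by parity (additive-p4 V23): a unit `δ̃_n` found there REFUTES `X4SharpThreeKimUnit` (or
one of that closure's named facts). [cite: Kim2022StructureSelmer, Conj. 1.10 (PDF p. 8)] [cite: Miller2011LMS, Def. 1.1] -/
theorem not_kuriharaUnitAt_of_kimRankZeroUnitBoundAt_of_bsdp_of_dvd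
    (hGZK : rank_eq_analyticRank_of_analyticRank_le_one) (h : KimRankZeroUnitBoundAt W p)
    (hsurj : W.HasSurjectiveModNGaloisRep p)
    (htower : ∀ n : ℕ, W.HasSurjectiveModNGaloisRep (p ^ n : ℕ)) (hL : W.entireLFunction 1 ≠ 0)
    {N : ℕ} [NeZero N] (D : ModularParametrizationData W N) (hc : ¬ (p : ℤ) ∣ D.maninConstant)
    (hper : ∃ u : ℚ, ‖(u : ℚ_[p])‖ = 1 ∧ W.realPeriodRat = u * plusPeriod D.f)
    (htam : p ∣ W.tamagawaProduct) (hB : BSDp W p) : ¬ X4.KuriharaUnitAt W p D.f := fun hK =>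
  (bsdp_iff_not_dvd_tamagawaProduct_of_kimRankZeroUnitBoundAt W p hGZK h hsurj htower hL D hc hper
    hK).mp hB htam

/-! ## §6 Census shapes at `p = 3` with the cell's tower certificates -/

/-- **N11 unit rows from the Kim shape: `X4SharpThreeKim` ⇒ `BSD(E,3)`** on X4 ∧ `r_an = 0` ∧ surj(3)
with a `3`-adic tower certificate (`j`-witness ∨ surj(9)), a datum `D` with `3 ∤ c_D`, `3 ∤ ∏ c_ℓ`,
`#Ш_an` a `3`-unit. CONDITIONAL on the conjecture (`hK3`); GZK, modularity. (The same rows are closed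
UNCONDITIONALLY by the Kato / (M) routes of `X4SharpThreeAssembly`; this is the Kim-shape reading.)
[cite: SerreAbelianLadic1968, Ch. IV §3.4] [cite: Miller2011LMS, §1 and Def. 1.1] -/
theorem X4RankZero.bsdp_three_of_kimShape_of_cert_of_shaAn_unit (hK3 : X4SharpThreeKim)
    (hGZK : rank_eq_analyticRank_of_analyticRank_le_one) (hmod : hasEntireLFunction_rat)
    (hr : W.analyticRank = 0) (hX : ClassX4 W 3) (hsurj : Surj W 3)
    (hcert : (∃ q : ℕ, q.Prime ∧ q ≠ 3 ∧ padicValRat q W.j < 0 ∧ ¬ (3 : ℤ) ∣ padicValRat q W.j) ∨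
      W.HasSurjectiveModNGaloisRep 9)
    {N : ℕ} [NeZero N] (D : ModularParametrizationData W N) (hc : ¬ (3 : ℤ) ∣ D.maninConstant)
    (htam : ¬ 3 ∣ W.tamagawaProduct) {q : ℚ} (hq : shaAn W = (q : ℂ)) (hv : padicValRat 3 q = 0) :
    BSDp W 3 :=
  bsdp_of_kimRankZeroBoundAt_of_shaAn_unit W 3 hGZK (hK3 W hX.2.1)
    ((W.analyticRank_eq_zero_iff_holds (hmod W)).mp hr) hsurj
    (towerSurj_three_of_surj_of_jWitness_or_nine W hsurj hcert) D hc htam hq hv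

/-- **N11 rows with `3 ∤ ∏ c_ℓ`: `X4SharpThreeKim` ⇒ the typed UPPER half `MissingUpperBoundAt W 3`**
(tower certificate, datum with `3 ∤ c_D`). CONDITIONAL on the conjecture. [cite: Miller2011LMS, Def. 1.1] -/
theorem X4RankZero.missingUpperBoundAt_three_of_kimShape_of_cert (hK3 : X4SharpThreeKim)
    (hGZK : rank_eq_analyticRank_of_analyticRank_le_one) (hmod : hasEntireLFunction_rat)
    (hr : W.analyticRank = 0) (hX : ClassX4 W 3) (hsurj : Surj W 3)
    (hcert : (∃ q : ℕ, q.Prime ∧ q ≠ 3 ∧ padicValRat q W.j < 0 ∧ ¬ (3 : ℤ) ∣ padicValRat q W.j) ∨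
      W.HasSurjectiveModNGaloisRep 9)
    {N : ℕ} [NeZero N] (D : ModularParametrizationData W N) (hc : ¬ (3 : ℤ) ∣ D.maninConstant)
    (htam : ¬ 3 ∣ W.tamagawaProduct) : MissingUpperBoundAt W 3 :=
  missingUpperBoundAt_of_kimRankZeroBoundAt W 3 hGZK (hK3 W hX.2.1)
    ((W.analyticRank_eq_zero_iff_holds (hmod W)).mp hr) hsurj
    (towerSurj_three_of_surj_of_jWitness_or_nine W hsurj hcert) D hc htam

/-- **THE LOWER LEVER AT `3`: `X4SharpThreeKimUnit` + ONE unit Kurihara number at `3` ⇒ `BSD(E,3)`**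
on X4 ∧ `r_an = 0` ∧ surj(3) ∧ tower certificate ∧ `3 ∤ c_D` ∧ period transfer ∧ `3 ∤ ∏ c_ℓ` —
with NO hypothesis on `#Ш_an`: the `3 ∣ #Ш_an` rows of N11 (additive-p4 V25b: 84 window rows with
`#Ш_an = 9`, one with `81`; sweep LOWER ≈ 8 550 across odd `p`), so far one `3`-descent certificate
each, become closable by a modular-symbol computation MODULO the conjecture. CONDITIONAL (`hK3u`).
[cite: Kim2022StructureSelmer, Thm. 1.9 (1), (6)] [cite: Miller2011LMS, Def. 1.1] -/
theorem X4RankZero.bsdp_three_of_kimUnitShape_of_cert_of_kuriharaUnitAt (hK3u : X4SharpThreeKimUnit)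
    (hGZK : rank_eq_analyticRank_of_analyticRank_le_one) (hmod : hasEntireLFunction_rat)
    (hr : W.analyticRank = 0) (hX : ClassX4 W 3) (hsurj : Surj W 3)
    (hcert : (∃ q : ℕ, q.Prime ∧ q ≠ 3 ∧ padicValRat q W.j < 0 ∧ ¬ (3 : ℤ) ∣ padicValRat q W.j) ∨
      W.HasSurjectiveModNGaloisRep 9)
    {N : ℕ} [NeZero N] (D : ModularParametrizationData W N) (hc : ¬ (3 : ℤ) ∣ D.maninConstant)
    (hper : ∃ u : ℚ, ‖(u : ℚ_[3])‖ = 1 ∧ W.realPeriodRat = u * plusPeriod D.f)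
    (htam : ¬ 3 ∣ W.tamagawaProduct) (hKu : X4.KuriharaUnitAt W 3 D.f) : BSDp W 3 :=
  bsdp_of_kimRankZeroUnitBoundAt_of_kuriharaUnitAt W 3 hGZK (hK3u W hX.2.1) hsurj
    (towerSurj_three_of_surj_of_jWitness_or_nine W hsurj hcert)
    ((W.analyticRank_eq_zero_iff_holds (hmod W)).mp hr) D hc hper htam hKu

/-- **The prediction at `3`: on an N11 tower row with `3 ∣ ∏ c_ℓ` where `BSD(E,3)` holds,
`X4SharpThreeKimUnit` forbids a unit cyclic-level Kurihara number at `3`.** Census target: the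
parity-closed Tamagawa-defect rows (additive-p4 V23/V24). CONDITIONAL (`hK3u`).
[cite: Kim2022StructureSelmer, Conj. 1.10] [cite: Miller2011LMS, Def. 1.1] -/
theorem X4RankZero.not_kuriharaUnitAt_three_of_kimUnitShape_of_bsdp_of_dvd
    (hK3u : X4SharpThreeKimUnit)
    (hGZK : rank_eq_analyticRank_of_analyticRank_le_one) (hmod : hasEntireLFunction_rat)
    (hr : W.analyticRank = 0) (hX : ClassX4 W 3) (hsurj : Surj W 3)
    (hcert : (∃ q : ℕ, q.Prime ∧ q ≠ 3 ∧ padicValRat q W.j < 0 ∧ ¬ (3 : ℤ) ∣ padicValRat q W.j) ∨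
      W.HasSurjectiveModNGaloisRep 9)
    {N : ℕ} [NeZero N] (D : ModularParametrizationData W N) (hc : ¬ (3 : ℤ) ∣ D.maninConstant)
    (hper : ∃ u : ℚ, ‖(u : ℚ_[3])‖ = 1 ∧ W.realPeriodRat = u * plusPeriod D.f)
    (htam : 3 ∣ W.tamagawaProduct) (hB : BSDp W 3) : ¬ X4.KuriharaUnitAt W 3 D.f :=
  not_kuriharaUnitAt_of_kimRankZeroUnitBoundAt_of_bsdp_of_dvd W 3 hGZK (hK3u W hX.2.1) hsurj
    (towerSurj_three_of_surj_of_jWitness_or_nine W hsurj hcert)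
    ((W.analyticRank_eq_zero_iff_holds (hmod W)).mp hr) D hc hper htam hB

end Summit.BirchSwinnertonDyer.Rank1Residual.Additive

end
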